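import Summits.NavierStokesRegularity.NavierStokesRegularity.Theorems.AxisymmetricExtremalityPFoldToAxisymmetricAxisPinningCore
import Literature.Analysis.FluidPDE.KatoGlobalSmallHolds
import Literature.Analysis.FluidPDE.RusinSverakCompactnessProofs
import Literature.Analysis.FluidPDE.KatoSymmetryCovariance

/-!
# Route AxisymmetricExtremality — crux `PFoldToAxisymmetric`, line `birth`: stub 2 `stub_axisPinning`

Support file (lead) for item stmt-NavierStokesRegularity-15454: proves the registered stub
`stub_axisPinning` of the skeleton `Lines/birth.lean` BY NAME and signature. Modulated `p_j`-fold
symmetric minimal blow-up data `v_j = λ_j W_j(λ_j · − x₀_j)` converging in `L³` to a minimal blow-up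
datum `u` have symmetry axes at bounded horizontal distance from the `x 2`-axis
(`horizontal_offsets_bounded`, `…AxisPinningCore`; the input `u ≠ 0` is
`eLpNorm_ne_zero_of_isMinimalBlowupDatum`: small `L³` data are global, Kato 1984 =
`kato_global_small_holds`), so along a subsequence the offsets converge (Bolzano–Weierstrass) and
the recentred fields `V_j = v_j(· + b_j)` — exactly equivariant about the `x 2`-axis itself —
converge in `L³` (strong continuity of translations, `tendsto_eLpNorm_comp_motion_sub`) to the
translate `u(· + a)`, again a minimal blow-up datum (translation invariance of Rusin–Šverák's `M`,
tree: `IsMinimalBlowupDatum.rescaleData_translate`, `exists_represents_rescaleData_norm_eq`).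

References: W. Rusin, V. Šverák, J. Funct. Anal. 260 (2011) = arXiv:0911.0500, §1 p. 3 and
Cor. 4.3 p. 8 [RusinSverak2011]; T. Kato, Math. Z. 187 (1984), Thms. 2–4 [Kato1984MathZ].
-/

noncomputable section

-- single-conjunct summit: `Summit.<Summit>.<Problem>` repeats the name by the D-0017 layout
set_option linter.dupNamespace false

namespace Summit.NavierStokesRegularity.NavierStokesRegularity.Theorems.PFoldToAxisymmetric.AxisPinning

open MeasureTheory Filter Topology Set Function
open scoped ENNReal NNReal
open Literature.Analysis.FluidPDE

/-! ### Minimal blow-up data: non-vanishing and translation invariance -/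

/-- **A minimal blow-up datum is not zero in `L³`**: data of small `L³` norm have global Kato
solutions (Kato 1984, `kato_global_small_holds`), minimal blow-up data have none.
[cite: Kato1984MathZ, Thms. 2–4] -/
theorem eLpNorm_ne_zero_of_isMinimalBlowupDatum {ν : ℝ} (hν : 0 < ν)
    {u : EuclideanSpace ℝ (Fin 3) → EuclideanSpace ℝ (Fin 3)}
    {g : Literature.Analysis.FunctionSpaces.HomSobolev (EuclideanSpace ℝ (Fin 3))
      (EuclideanSpace ℂ (Fin 3)) (1 / 2 : ℝ)}
    (h : IsMinimalBlowupDatum ν u g) : eLpNorm u 3 volume ≠ 0 := by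
  intro h0
  obtain ⟨δ, -, hK⟩ := kato_global_small_holds
  have hle : eLpNorm u 3 volume ≤ ENNReal.ofReal (δ * ν) := by
    rw [h0]
    exact zero_le
  obtain ⟨w, hw, hcont, hw0, hmeas, -, -⟩ := hK ν hν u h.1 h.2.2.1 hle
  exact h.2.2.2.2 ⟨w, hw, hcont, hw0, hmeas⟩

/-- **Translation invariance of Rusin–Šverák's set `M`** (tree:
`IsMinimalBlowupDatum.rescaleData_translate` with scale `1` and a representing class of the same
norm from `exists_represents_rescaleData_norm_eq`): `u(· + a)` is again a minimal blow-up datum.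
[cite: RusinSverak2011, Cor. 4.3 (arXiv:0911.0500 p. 8) with §1 (p. 3)] -/
theorem exists_isMinimalBlowupDatum_translate {ν : ℝ}
    {u : EuclideanSpace ℝ (Fin 3) → EuclideanSpace ℝ (Fin 3)}
    {g : Literature.Analysis.FunctionSpaces.HomSobolev (EuclideanSpace ℝ (Fin 3))
      (EuclideanSpace ℂ (Fin 3)) (1 / 2 : ℝ)}
    (h : IsMinimalBlowupDatum ν u g) (a : EuclideanSpace ℝ (Fin 3)) :
    ∃ g' : Literature.Analysis.FunctionSpaces.HomSobolev (EuclideanSpace ℝ (Fin 3))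
      (EuclideanSpace ℂ (Fin 3)) (1 / 2 : ℝ), IsMinimalBlowupDatum ν (fun x => u (x + a)) g' := by
  obtain ⟨g', hrep, hnorm⟩ := exists_represents_rescaleData_norm_eq u g one_pos (-a) h.2.1
  refine ⟨g', ?_⟩
  have h1 := h.rescaleData_translate one_pos (-a) hrep hnorm
  have h2 : (rescaleData 1 fun x => u (x - -a)) = fun x => u (x + a) := by
    funext x
    simp [rescaleData, sub_neg_eq_add]
  rwa [h2] at h1

/-! ### The stub -/

/-- **Stub 2 (axis pinning — the load-bearing lemma).** Let `(W j, G j)` be minimal blow-up data,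
`W j` equivariant under the rotation by `2π/q j` about the `x 2`-axis, `q j → ∞`, and suppose the
modulated data `x ↦ lam j • W j (lam j • x - x₀ j)` (`lam j > 0`) converge in `L³` to a minimal
blow-up datum `u`. Then the symmetry axes (the vertical lines through `x₀ j / lam j`) stay at bounded
distance from the `x 2`-axis, so that after a horizontal recentring one obtains `L³` fields `V j`,
equivariant under the rotation by `2π/q' j` about the `x 2`-axis itself with `q' j → ∞`, converging in
`L³` to a minimal blow-up datum `u'`. (`u ∈ M ⇒ u ≠ 0`; `horizontal_offsets_bounded`;
Bolzano–Weierstrass; continuity of translations in `L³`; translation invariance of `M`.) [folklore] -/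
theorem stub_axisPinning :
    ∀ ν : ℝ, 0 < ν →
    ∀ (W : ℕ → EuclideanSpace ℝ (Fin 3) → EuclideanSpace ℝ (Fin 3))
      (G : ℕ → Literature.Analysis.FunctionSpaces.HomSobolev (EuclideanSpace ℝ (Fin 3))
        (EuclideanSpace ℂ (Fin 3)) (1 / 2 : ℝ))
      (q : ℕ → ℕ) (lam : ℕ → ℝ) (x₀ : ℕ → EuclideanSpace ℝ (Fin 3))
      (u : EuclideanSpace ℝ (Fin 3) → EuclideanSpace ℝ (Fin 3))
      (g : Literature.Analysis.FunctionSpaces.HomSobolev (EuclideanSpace ℝ (Fin 3))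
        (EuclideanSpace ℂ (Fin 3)) (1 / 2 : ℝ)),
      (∀ j, Literature.Analysis.FluidPDE.IsMinimalBlowupDatum ν (W j) (G j)) →
      (∀ j (x : EuclideanSpace ℝ (Fin 3)),
        W j (WithLp.toLp 2 ![Real.cos (2 * Real.pi / q j) * x 0 - Real.sin (2 * Real.pi / q j) * x 1,
          Real.sin (2 * Real.pi / q j) * x 0 + Real.cos (2 * Real.pi / q j) * x 1, x 2]) =
        WithLp.toLp 2 ![Real.cos (2 * Real.pi / q j) * W j x 0 - Real.sin (2 * Real.pi / q j) * W j x 1,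
          Real.sin (2 * Real.pi / q j) * W j x 0 + Real.cos (2 * Real.pi / q j) * W j x 1, W j x 2]) →
      Tendsto q atTop atTop →
      (∀ j, 0 < lam j) →
      Literature.Analysis.FluidPDE.IsMinimalBlowupDatum ν u g →
      Tendsto (fun j => eLpNorm
        (Literature.Analysis.FluidPDE.rescaleData (lam j) (fun x => W j (x - x₀ j)) - u)
        3 volume) atTop (𝓝 0) →
      ∃ (u' : EuclideanSpace ℝ (Fin 3) → EuclideanSpace ℝ (Fin 3))
        (g' : Literature.Analysis.FunctionSpaces.HomSobolev (EuclideanSpace ℝ (Fin 3))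
          (EuclideanSpace ℂ (Fin 3)) (1 / 2 : ℝ)),
        Literature.Analysis.FluidPDE.IsMinimalBlowupDatum ν u' g' ∧
        ∃ (q' : ℕ → ℕ) (V : ℕ → EuclideanSpace ℝ (Fin 3) → EuclideanSpace ℝ (Fin 3)),
          Tendsto q' atTop atTop ∧ (∀ j, MemLp (V j) 3 volume) ∧
          (∀ j (x : EuclideanSpace ℝ (Fin 3)),
            V j (WithLp.toLp 2 ![Real.cos (2 * Real.pi / q' j) * x 0 - Real.sin (2 * Real.pi / q' j) * x 1,
              Real.sin (2 * Real.pi / q' j) * x 0 + Real.cos (2 * Real.pi / q' j) * x 1, x 2]) =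
            WithLp.toLp 2 ![Real.cos (2 * Real.pi / q' j) * V j x 0 - Real.sin (2 * Real.pi / q' j) * V j x 1,
              Real.sin (2 * Real.pi / q' j) * V j x 0 + Real.cos (2 * Real.pi / q' j) * V j x 1, V j x 2]) ∧
          Tendsto (fun j => eLpNorm (V j - u') 3 volume) atTop (𝓝 0) := by
  intro ν hν W G q lam x₀ u g hmin hsym hq hlam hminu hconv
  -- notation: modulated data, angles, horizontal offsets of the symmetry axes
  set v : ℕ → EuclideanSpace ℝ (Fin 3) → EuclideanSpace ℝ (Fin 3) :=
    fun j => rescaleData (lam j) (fun x => W j (x - x₀ j)) with hv_def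
  set θ : ℕ → ℝ := fun j => 2 * Real.pi / (q j : ℝ) with hθ_def
  set b : ℕ → EuclideanSpace ℝ (Fin 3) :=
    fun j => WithLp.toLp 2 ![((lam j)⁻¹ • x₀ j) 0, ((lam j)⁻¹ • x₀ j) 1, 0] with hb_def
  have hu : MemLp u 3 volume := hminu.1
  have hu0 : eLpNorm u 3 volume ≠ 0 := eLpNorm_ne_zero_of_isMinimalBlowupDatum hν hminu
  have hv : ∀ j, MemLp (v j) 3 volume := fun j =>
    memLp_three_rescaleData ((hmin j).1.comp_measurePreserving
      (measurePreserving_sub_right volume (x₀ j))) (hlam j)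
  have hb2 : ∀ j, b j 2 = 0 := fun j => by simp [hb_def]
  have hθ0 : Tendsto θ atTop (𝓝 0) :=
    tendsto_const_nhds.div_atTop (tendsto_natCast_atTop_atTop.comp hq)
  -- exact equivariance of the modulated data about the axis through `b j`, with all iterates
  have hequiv : ∀ j (m : ℕ) (x : EuclideanSpace ℝ (Fin 3)),
      v j (rotZ (m * θ j) x + (b j - rotZ (m * θ j) (b j))) = rotZ (m * θ j) (v j x) := by
    intro j m x
    have hW : ∀ y, W j (rotZ (θ j) y) = rotZ (θ j) (W j y) := fun y => hsym j y
    have hm : ∀ y, W j (rotZ (m * θ j) y) = rotZ (m * θ j) (W j y) := rotZ_equivariant_nsmul hW m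
    have h2 := rescaleData_translate_equivariant hm (hlam j).ne' (x₀ j) x
    rw [sub_rotZ_eq_horizontal] at h2
    exact h2
  -- from some index `J` on the orders of symmetry are `≥ 1`; shift by `J`
  obtain ⟨J, hJ⟩ := eventually_atTop.1 (hq.eventually_ge_atTop 1)
  have hθpos : ∀ j, 0 < θ (j + J) := fun j => by
    have h1 : (1 : ℝ) ≤ q (j + J) := by exact_mod_cast hJ (j + J) (Nat.le_add_left J j)
    exact div_pos Real.two_pi_pos (by linarith)
  obtain ⟨C, hC⟩ := horizontal_offsets_bounded hu hu0 (fun j => hv (j + J))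
    (hconv.comp (tendsto_add_atTop_nat J)) hθpos (hθ0.comp (tendsto_add_atTop_nat J))
    (fun j => hb2 (j + J)) (fun j m x => hequiv (j + J) m x)
  -- Bolzano–Weierstrass for the bounded offsets
  obtain ⟨a, -, ψ, hψ, hlimb⟩ := tendsto_subseq_of_bounded (Metric.isBounded_closedBall
    (x := (0 : EuclideanSpace ℝ (Fin 3))) (r := C)) (fun j => mem_closedBall_zero_iff.2 (hC j))
  -- the recentred subsequence
  set idx : ℕ → ℕ := fun j => ψ j + J with hidx
  have hidx_t : Tendsto idx atTop atTop := (tendsto_add_atTop_nat J).comp hψ.tendsto_atTop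
  have hlimb' : Tendsto (fun j => b (idx j)) atTop (𝓝 a) := hlimb
  obtain ⟨g', hg'⟩ := exists_isMinimalBlowupDatum_translate hminu a
  refine ⟨fun x => u (x + a), g', hg', fun j => q (idx j), fun j x => v (idx j) (x + b (idx j)),
    hq.comp hidx_t, fun j => (hv (idx j)).comp_measurePreserving (measurePreserving_add_right volume _),
    fun j x => ?_, ?_⟩
  · -- exact equivariance about the `x 2`-axis after recentring
    have h1 := fun y => hequiv (idx j) 1 y
    simp only [Nat.cast_one, one_mul] at h1
    exact translate_equivariant h1 x
  · -- `L³` convergence to `u(· + a)`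
    have hmeas1 : ∀ j, AEStronglyMeasurable (fun x => v (idx j) (x + b (idx j)) - u (x + b (idx j))) volume :=
      fun j => ((hv (idx j)).sub hu).aestronglyMeasurable.comp_measurePreserving
        (measurePreserving_add_right volume _)
    have hmeas2 : ∀ c : EuclideanSpace ℝ (Fin 3), AEStronglyMeasurable (fun x => u (x + c)) volume :=
      fun c => hu.aestronglyMeasurable.comp_measurePreserving (measurePreserving_add_right volume c)
    have hle : ∀ j, eLpNorm ((fun x => v (idx j) (x + b (idx j))) - fun x => u (x + a)) 3 volume ≤
        eLpNorm (v (idx j) - u) 3 volume +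
          eLpNorm (fun x => u (rotZ 0 x + b (idx j)) - u (rotZ 0 x + a)) 3 volume := fun j => by
      have hsplit : ((fun x => v (idx j) (x + b (idx j))) - fun x => u (x + a)) =
          (fun x => v (idx j) (x + b (idx j)) - u (x + b (idx j))) +
            fun x => u (rotZ 0 x + b (idx j)) - u (rotZ 0 x + a) := by
        funext x
        simp only [Pi.sub_apply, Pi.add_apply, rotZ_zero, sub_add_sub_cancel]
      rw [hsplit]
      refine (eLpNorm_add_le (hmeas1 j) ?_ (by norm_num)).trans ?_
      · exact ((hmeas2 (b (idx j))).sub (hmeas2 a)).congr (Eventually.of_forall fun x => by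
          simp only [Pi.sub_apply, rotZ_zero])
      · refine add_le_add (le_of_eq ?_) le_rfl
        exact eLpNorm_comp_measurePreserving (p := 3) ((hv (idx j)).sub hu).aestronglyMeasurable
          (measurePreserving_add_right volume _)
    have hlim : Tendsto (fun j => eLpNorm (v (idx j) - u) 3 volume +
        eLpNorm (fun x => u (rotZ 0 x + b (idx j)) - u (rotZ 0 x + a)) 3 volume) atTop (𝓝 0) := by
      have h1 := hconv.comp hidx_t
      have h2 := tendsto_eLpNorm_comp_motion_sub hu (θ := fun _ : ℕ => (0 : ℝ))
        tendsto_const_nhds hlimb'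
      simpa using h1.add h2
    exact tendsto_of_tendsto_of_tendsto_of_le_of_le tendsto_const_nhds hlim (fun _ => zero_le) hle

end Summit.NavierStokesRegularity.NavierStokesRegularity.Theorems.PFoldToAxisymmetric.AxisPinning

end
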